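import Literature.AlgebraicGeometry.Villamayor2007.HElimAlgebraGenerators
import Mathlib.RingTheory.LocalRing.ResidueField.Ideal
import Mathlib.FieldTheory.IsAlgClosed.AlgebraicClosure
import HarnessLib

/-!
# Villamayor 2007, Thm. 1.16 (i) ON `Spec S`, in COMPUTABLE form: the purely ramified locus of
# `Spec(S[Z]/⟨f⟩) → Spec S` is the zero set of the weighted characteristic coefficients `ψ_{Δ^e f, n}` — PROVED

O. E. Villamayor U., *Hypersurface singularities in positive characteristic*, Adv. Math. **213** (2007) 687–733
= arXiv:math/0606796 [Villamayor2007]: Introduction p0004 L86–L102, 1.1 p0006 L30–L39, Thm. 1.16 p0009 L55–L96,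
Def. 1.21 p0010 L50–L53, Def. 1.42 p0014 L16–L64. Locators «p00NN Lnn» = chunk · line of the held arXiv text
(`lit read paper:arxiv-math_0606796`; p0004, p0006, p0009, p0010 re-read before typing). Campaign `res-hironaka`
(D-0089), ladder rung LIT-6. PROOF file: theorems only, NO definitions, NO named facts; nothing of Hironaka's
2017 manuscript is referred to or asserted. Sequel of `PurelyRamifiedLocus.lean` (Thm. 1.16 (i) at a point
`φ : S → K`, `K` a domain where `φ(f)` splits: `map_eq_X_sub_C_pow_iff_elimIdeal_le_ker`) and
`HElimAlgebraGenerators.lean` (the generators of `ℋ_f` are the weighted coefficients of `ψ_{Δ^e f}`).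

## What is proved

* `forall_elimIdeal_le_iff_exists_map_eq_pow`, `forall_hElimIdeal_le_iff_exists_map_eq_pow` — **Thm. 1.16 (i) as
  printed, on the prime spectrum** (p0009 L55–L64 «Let `R` be a `k` algebra, `f(Z) = Z^b + a_1Z^{b−1} + … + a_b ∈
  R[Z]`, and set `Spec(R[Z]/⟨f(Z)⟩) → Spec(R)`. Then: i) `V(⟨G_{b,1}(a_1,…,a_b),…,G_{b,r_b}(a_1,…,a_b)⟩)` is the set of
  points in `Spec(R)` where the finite morphism is purely ramified»; 1.1 p0006 L35–L39 «purely ramified at `P` if and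
  only if the class of `f(Z)` in `k(P)̄[Z]` has a unique root»): for a PRIME `P ⊂ S`, all `I_r(f) ⊆ P` (`r ≥ 1`;
  equivalently all `I^{(2)}_r(f) ⊆ P`, the ideals of `ℋ_f`) iff `f = monicOf a` becomes `(Z − α)^b` over an
  algebraic closure of the residue field `k(P)` (Mathlib `Ideal.ResidueField`, `AlgebraicClosure`) — the point
  theorem of `PurelyRamifiedLocus.lean` at the geometric point `S → k(P) → k(P)̄`, whose kernel is `P`.
* `hElimIdeal_le_of_coeff_mulCharpoly_hasseDeriv_mem`, `forall_hElimIdeal_le_iff_coeff_mulCharpoly_hasseDeriv_mem`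
  — for ANY ideal `P`: all `I^{(2)}_r ⊆ P` (`r ≥ 1`) iff the finitely many weighted coefficients `ψ_{Δ^e f, n}`
  (`1 ≤ e ≤ b − 1`, `0 ≤ n < b`) lie in `P` — because `ℋ_f = S[ψ_{Δ^e f, n}·W^{(b−n)(b−e)}]`
  (`hElimAlgebra_eq_mulCharpolyReesOfFamily`, Def. 1.42 (1.42.3) / BV2010 (2.8.1)) and every generator has POSITIVE
  weight (the subalgebra `{q ∈ S[W] ; coeff_{≥1} q ∈ P}` contains them).
* `exists_map_eq_pow_iff_coeff_mulCharpoly_hasseDeriv_mem` — **the computable purely-ramified criterion**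
  (Introduction p0004 L93–L97 «These universal polynomials … are to be thought of as generalized discriminants.
  When evaluated on the coefficients of `f(Z)`, these generalized discriminants define `F ⊂ Spec(S)`. The main result
  in Section 1 is Theorem (ramlocus) which characterizes `F` in `Spec(S)` in terms of ramification theory»): for a
  prime `P` of ANY commutative ring `S` and `f = monicOf a` monic of degree `b`, `f` has a unique root over `k(P)̄`
  iff `coeff_n ψ_{Δ^e f} ∈ P` for all `1 ≤ e ≤ b − 1`, `n < b` — a statement free of `k` (the elimination theory is
  run over `k = ℤ` inside the proof).
* `exists_map_eq_pow_two_iff` — `b = 2`: `Z² + a₁Z + a₂` is purely ramified at `P` iff `4a₂ − a₁² ∈ P` (the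
  discriminant; Introduction p0004 L91 «Among these equations is the discriminant of `f(Z)`»).
* Scope / NOT claimed: Thm. 1.16 (ii) (orders at `b`-fold points) is `OrderAlongSection.lean` (ideal form, modulo
  rationality); for `b = 0` the right-hand side is trivially true (degenerate, empty fibres); `S` any commutative
  ring, `k` any commutative ring with `S` a `k`-algebra.

## References

* O. E. Villamayor U., Adv. Math. 213 (2007) 687–733 = arXiv:math/0606796: Introduction, 1.1, Thm. 1.16, Def. 1.21,
  Def. 1.42. [Villamayor2007]
* A. Bravo, O. E. Villamayor U., Adv. Math. 224 (2010) 1349–1418 = arXiv:0807.4308: Paragraph 2.8 (2.8.1).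
  [BravoVillamayor2010]
-/

noncomputable section

open scoped Polynomial

namespace Literature.AlgebraicGeometry.Villamayor2007

open MvPolynomial

universe u v w

/-! ## The weighted coefficients cut out `V(I^{(2)}_r : r ≥ 1)` (any ideal) -/

section Computable

variable (k : Type v) [CommRing k] {S : Type w} [CommRing S] [Algebra k S] {b : ℕ}

/-- If every ideal `I^{(2)}_r` (`r ≥ 1`) of `ℋ_f` lies in `P`, then so does every weighted coefficient `ψ_{Δ^e f, n}`,
`1 ≤ e ≤ b − 1`, `n < b` (it lies in `I^{(2)}_{(b−n)(b−e)}`, `HElimAlgebraGenerators.coeff_mulCharpoly_hasseDeriv_mem_hElimIdeal`).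
[cite: Villamayor2007, Def. 1.42 (1.42.3) p0014 L47–L54] -/
theorem coeff_mulCharpoly_hasseDeriv_mem_of_forall_hElimIdeal_le (a : Fin b → S) (P : Ideal S)
    (h : ∀ r : ℕ, 1 ≤ r → hElimIdeal k a r ≤ P) {e n : ℕ} (he1 : 1 ≤ e) (he : e + 1 ≤ b) (hn : n < b) :
    (mulCharpoly (monicOf a) (monicOf_monic a) (Polynomial.hasseDeriv e (monicOf a))).coeff n ∈ P :=
  h _ (Nat.one_le_iff_ne_zero.mpr (Nat.mul_ne_zero (by omega) (by omega)))
    (coeff_mulCharpoly_hasseDeriv_mem_hElimIdeal k a he1 he hn.le)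

/-- **The weighted coefficients cut out `V(ℋ_f^{+})`** (any ideal `P ⊂ S`): if `coeff_n ψ_{Δ^e f} ∈ P` for all
`1 ≤ e ≤ b − 1`, `n < b`, then `I^{(2)}_r(f) ⊆ P` for every `r ≥ 1` — every generator `H(a)·W^r` of `ℋ_f` lies in
`S[ψ_{Δ^e f, n}·W^{(b−n)(b−e)}]` (`monomial_specialize_mem_mulCharpolyReesOfFamily`), all of whose generators have
positive weight and coefficient in `P`, hence in the subalgebra `{q ∈ S[W] ; coeff_i q ∈ P for i ≥ 1}`. (Introduction
p0004 L95–L96 «When evaluated on the coefficients of `f(Z)`, these generalized discriminants define `F ⊂ Spec(S)`».)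
[cite: Villamayor2007, Introduction p0004 L93–L97] -/
theorem hElimIdeal_le_of_coeff_mulCharpoly_hasseDeriv_mem (a : Fin b → S) (P : Ideal S)
    (h : ∀ e n : ℕ, 1 ≤ e → e + 1 ≤ b → n < b →
      (mulCharpoly (monicOf a) (monicOf_monic a) (Polynomial.hasseDeriv e (monicOf a))).coeff n ∈ P)
    {r : ℕ} (hr : 1 ≤ r) : hElimIdeal k a r ≤ P := by
  rcases subsingleton_or_nontrivial S with hS | hS
  · intro x _; rw [Subsingleton.elim x 0]; exact zero_mem _
  -- the `S`-subalgebra of `S[W]` of polynomials whose positive-degree coefficients lie in `P`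
  let B : Subalgebra S S[X] :=
    { carrier := {q | ∀ i : ℕ, 1 ≤ i → q.coeff i ∈ P}
      mul_mem' := by
        intro q q' hq hq' i hi
        rw [Set.mem_setOf_eq] at hq hq'
        rw [Polynomial.coeff_mul]
        refine P.sum_mem fun jl hjl => ?_
        have hsum := Finset.mem_antidiagonal.mp hjl
        rcases Nat.eq_zero_or_pos jl.1 with h0 | h0
        · exact P.mul_mem_left _ (hq' jl.2 (by omega))
        · exact P.mul_mem_right _ (hq jl.1 h0)
      add_mem' := by
        intro q q' hq hq' i hi
        rw [Polynomial.coeff_add]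
        exact P.add_mem (hq i hi) (hq' i hi)
      algebraMap_mem' := by
        intro s i hi
        show (Polynomial.C s).coeff i ∈ P
        rw [Polynomial.coeff_C, if_neg (by omega)]
        exact P.zero_mem }
  -- it contains the weighted coefficient algebra
  have hA : mulCharpolyReesOfFamily (monicOf a) (monicOf_monic a)
      {gn | ∃ e : ℕ, 1 ≤ e ∧ e + 1 ≤ b ∧ gn = (Polynomial.hasseDeriv e (monicOf a), b - e)} ≤ B := by
    unfold mulCharpolyReesOfFamily
    refine iSup₂_le fun gn hgn => ?_
    obtain ⟨e, he1, he, rfl⟩ := hgn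
    dsimp only
    unfold mulCharpolyRees
    refine Algebra.adjoin_le ?_
    rintro _ ⟨j, hj1, hj, rfl⟩
    rw [natDegree_monicOf] at hj ⊢
    intro i hi
    show (Polynomial.monomial (j * (b - e)) _).coeff i ∈ P
    rw [Polynomial.coeff_monomial]
    split_ifs
    · exact h e (b - j) he1 he (by omega)
    · exact P.zero_mem
  -- generators `H(a)` of `I^{(2)}_r`: `H(a)·W^r ∈ A ≤ B`, read off the coefficient of `W^r`
  refine Ideal.span_le.mpr ?_
  rintro _ ⟨H, hH, hhom, rfl⟩
  have hmem := hA (monomial_specialize_mem_mulCharpolyReesOfFamily k a hH hhom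
    (hSubalgebra_le_symmetricSubalgebra hH))
  have hc := hmem r hr
  rwa [Polynomial.coeff_monomial, if_pos rfl] at hc

/-- `V(I^{(2)}_r : r ≥ 1) = V(ψ_{Δ^e f, n} : 1 ≤ e ≤ b − 1, n < b)` as sets of (arbitrary) ideals of `S`.
[cite: Villamayor2007, Introduction p0004 L93–L97] -/
theorem forall_hElimIdeal_le_iff_coeff_mulCharpoly_hasseDeriv_mem (a : Fin b → S) (P : Ideal S) :
    (∀ r : ℕ, 1 ≤ r → hElimIdeal k a r ≤ P) ↔
      ∀ e n : ℕ, 1 ≤ e → e + 1 ≤ b → n < b →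
        (mulCharpoly (monicOf a) (monicOf_monic a) (Polynomial.hasseDeriv e (monicOf a))).coeff n ∈ P :=
  ⟨fun h _ _ he1 he hn => coeff_mulCharpoly_hasseDeriv_mem_of_forall_hElimIdeal_le k a P h he1 he hn,
    fun h _ hr => hElimIdeal_le_of_coeff_mulCharpoly_hasseDeriv_mem k a P h hr⟩

end Computable

section Spec

variable (k : Type v) [CommRing k] {S : Type w} [CommRing S] [Algebra k S] {b : ℕ}

/-! ## Thm. 1.16 (i) on `Spec S`: the purely ramified locus -/

/-- **Thm. 1.16 (i) as printed** [Villamayor 2007, Thm. 1.16 (i) p0009 L55–L64 «`V(⟨G_{b,1}(a_1,…,a_b),…,G_{b,r_b}(a_1,…,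
a_b)⟩)` is the set of points in `Spec(R)` where the finite morphism is purely ramified», with 1.1 p0006 L35–L39 «the
morphism is purely ramified at `P` if and only if the class of `f(Z)` in `k(P)̄[Z]` has a unique root»]: for a prime
`P ⊂ S` and `f = monicOf a`, ALL elimination ideals `I_r(f)`, `r ≥ 1`, lie in `P` iff `f` maps to `(Z − α)^b` in
`k(P)̄[Z]`, `k(P)̄` = an algebraic closure (`AlgebraicClosure`) of the residue field `k(P)` (`Ideal.ResidueField P`).
Proof: `PurelyRamifiedLocus.map_eq_X_sub_C_pow_iff_elimIdeal_le_ker` at the geometric point `S → k(P) → k(P)̄`, whose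
kernel is `P` (`Ideal.ker_algebraMap_residueField`) and over which every polynomial splits. (`b = 0`: both sides
degenerate-true.) [cite: Villamayor2007, Thm. 1.16 (i) p0009 L55–L64] -/
theorem forall_elimIdeal_le_iff_exists_map_eq_pow (a : Fin b → S) (P : Ideal S) [P.IsPrime] :
    (∀ r : ℕ, 1 ≤ r → elimIdeal k a r ≤ P) ↔
      ∃ α : AlgebraicClosure P.ResidueField,
        (monicOf a).map (algebraMap S (AlgebraicClosure P.ResidueField)) =
          (Polynomial.X - Polynomial.C α) ^ b := by
  letI : Algebra k (AlgebraicClosure P.ResidueField) :=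
    ((algebraMap S (AlgebraicClosure P.ResidueField)).comp (algebraMap k S)).toAlgebra
  let φ : S →ₐ[k] AlgebraicClosure P.ResidueField :=
    { algebraMap S (AlgebraicClosure P.ResidueField) with commutes' := fun _ => rfl }
  have hφ : (φ : S →+* AlgebraicClosure P.ResidueField) = algebraMap S (AlgebraicClosure P.ResidueField) :=
    rfl
  have hker : RingHom.ker (φ : S →+* AlgebraicClosure P.ResidueField) = P := by
    rw [hφ, IsScalarTower.algebraMap_eq S P.ResidueField (AlgebraicClosure P.ResidueField),
      ← RingHom.comap_ker, (RingHom.injective_iff_ker_eq_bot _).mp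
        (algebraMap P.ResidueField (AlgebraicClosure P.ResidueField)).injective,
      ← RingHom.ker_eq_comap_bot, Ideal.ker_algebraMap_residueField]
  have hsplit : ((monicOf a).map (φ : S →+* AlgebraicClosure P.ResidueField)).Splits :=
    IsAlgClosed.splits _
  have h := map_eq_X_sub_C_pow_iff_elimIdeal_le_ker k φ a hsplit
  rw [hker] at h
  rw [← hφ]
  exact h.symm

/-- Thm. 1.16 (i) with the ideals `I^{(2)}_r` of the computable algebra `ℋ_f` in place of the `I_r` (the printed proof,
p0009 L80–L96, only uses `⟨F_b^{(1)}(Y_1),…,F_b^{(b−1)}(Y_1)⟩`, i.e. `H_{F_b}`): all `I^{(2)}_r(f) ⊆ P` (`r ≥ 1`) iff `f`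
is a pure `b`-th power over `k(P)̄`. [cite: Villamayor2007, Thm. 1.16 (i) p0009 L55–L96] -/
theorem forall_hElimIdeal_le_iff_exists_map_eq_pow (a : Fin b → S) (P : Ideal S) [P.IsPrime] :
    (∀ r : ℕ, 1 ≤ r → hElimIdeal k a r ≤ P) ↔
      ∃ α : AlgebraicClosure P.ResidueField,
        (monicOf a).map (algebraMap S (AlgebraicClosure P.ResidueField)) =
          (Polynomial.X - Polynomial.C α) ^ b := by
  letI : Algebra k (AlgebraicClosure P.ResidueField) :=
    ((algebraMap S (AlgebraicClosure P.ResidueField)).comp (algebraMap k S)).toAlgebra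
  let φ : S →ₐ[k] AlgebraicClosure P.ResidueField :=
    { algebraMap S (AlgebraicClosure P.ResidueField) with commutes' := fun _ => rfl }
  have hφ : (φ : S →+* AlgebraicClosure P.ResidueField) = algebraMap S (AlgebraicClosure P.ResidueField) :=
    rfl
  have hker : RingHom.ker (φ : S →+* AlgebraicClosure P.ResidueField) = P := by
    rw [hφ, IsScalarTower.algebraMap_eq S P.ResidueField (AlgebraicClosure P.ResidueField),
      ← RingHom.comap_ker, (RingHom.injective_iff_ker_eq_bot _).mp
        (algebraMap P.ResidueField (AlgebraicClosure P.ResidueField)).injective,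
      ← RingHom.ker_eq_comap_bot, Ideal.ker_algebraMap_residueField]
  constructor
  · intro h
    have hsplit : ((monicOf a).map (φ : S →+* AlgebraicClosure P.ResidueField)).Splits :=
      IsAlgClosed.splits _
    have h' := exists_map_eq_X_sub_C_pow_of_hElimIdeal_le_ker k φ a hsplit (by rw [hker]; exact h)
    rwa [hφ] at h'
  · intro h r hr
    exact (hElimIdeal_le_elimIdeal a r).trans
      (((forall_elimIdeal_le_iff_exists_map_eq_pow k a P).mpr h) r hr)

/-- **Thm. 1.16 (i), computable form — the purely ramified locus is the zero set of the weighted characteristic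
coefficients** [Villamayor 2007, Introduction p0004 L93–L97 «generalized discriminants … define `F ⊂ Spec(S)`. The main
result in Section 1 is Theorem (ramlocus) which characterizes `F` in `Spec(S)` in terms of ramification theory … it is
the set of points over which the geometric fiber of `σ` is a unique point»; Thm. 1.16 (i) p0009 L55–L64]: for a prime
`P` of a commutative ring `S` and `f = monicOf a ∈ S[Z]` monic of degree `b`, the class of `f` in `k(P)̄[Z]` has a
unique root iff `coeff_n ψ_{Δ^e f} ∈ P` for all `1 ≤ e ≤ b − 1` and `n < b`, `ψ_g` = the characteristic polynomial of
multiplication by `g` on `S[Z]/⟨f⟩` (`MultiplicationCharpoly.mulCharpoly`). The statement does not mention the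
coefficient ring `k` of the universal theory; the proof runs it over `k = ℤ`.
[cite: Villamayor2007, Thm. 1.16 (i) p0009 L55–L64] -/
theorem exists_map_eq_pow_iff_coeff_mulCharpoly_hasseDeriv_mem (a : Fin b → S) (P : Ideal S) [P.IsPrime] :
    (∃ α : AlgebraicClosure P.ResidueField,
        (monicOf a).map (algebraMap S (AlgebraicClosure P.ResidueField)) =
          (Polynomial.X - Polynomial.C α) ^ b) ↔
      ∀ e n : ℕ, 1 ≤ e → e + 1 ≤ b → n < b →
        (mulCharpoly (monicOf a) (monicOf_monic a) (Polynomial.hasseDeriv e (monicOf a))).coeff n ∈ P := by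
  -- the criterion does not mention `k`: run the elimination theory over `k = ℤ`
  rw [← forall_hElimIdeal_le_iff_exists_map_eq_pow ℤ a P,
    forall_hElimIdeal_le_iff_coeff_mulCharpoly_hasseDeriv_mem ℤ a P]

/-- `b = 2`: `Z² + a₁Z + a₂` is purely ramified at the prime `P` iff its discriminant lies in `P` (`4a₂ − a₁² ∈ P`) —
«Among these equations is the discriminant of `f(Z)`» (Introduction p0004 L91); via `mulCharpoly_hasseDeriv_one_monicOf_two`.
[cite: Villamayor2007, Introduction p0004 L86–L102] -/
theorem exists_map_eq_pow_two_iff (a : Fin 2 → S) (P : Ideal S) [P.IsPrime] :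
    (∃ α : AlgebraicClosure P.ResidueField,
        (monicOf a).map (algebraMap S (AlgebraicClosure P.ResidueField)) =
          (Polynomial.X - Polynomial.C α) ^ 2) ↔ 4 * a 1 - a 0 ^ 2 ∈ P := by
  rw [exists_map_eq_pow_iff_coeff_mulCharpoly_hasseDeriv_mem]
  have hc0 : (Polynomial.X ^ 2 + Polynomial.C (4 * a 1 - a 0 ^ 2) : S[X]).coeff 0 = 4 * a 1 - a 0 ^ 2 := by
    rw [Polynomial.coeff_add, Polynomial.coeff_X_pow, Polynomial.coeff_C_zero, if_neg (by norm_num), zero_add]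
  have hc1 : (Polynomial.X ^ 2 + Polynomial.C (4 * a 1 - a 0 ^ 2) : S[X]).coeff 1 = 0 := by
    rw [Polynomial.coeff_add, Polynomial.coeff_X_pow, Polynomial.coeff_C, if_neg (by norm_num),
      if_neg (by norm_num), add_zero]
  constructor
  · intro h
    have h0 := h 1 0 le_rfl le_rfl (by norm_num)
    rwa [mulCharpoly_hasseDeriv_one_monicOf_two, hc0] at h0
  · intro hd e n he1 he hn
    obtain rfl : e = 1 := by omega
    rw [mulCharpoly_hasseDeriv_one_monicOf_two]
    interval_cases n
    · rwa [hc0]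
    · rw [hc1]; exact P.zero_mem

end Spec

end Literature.AlgebraicGeometry.Villamayor2007

end
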